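import Literature.NumberTheory.Sieve.FriedlanderIwaniecPrimesJacobiTwistedFlip
import HarnessLib

/-!
# Friedlander–Iwaniec, *The polynomial `X² + Y⁴` captures its primes*, §12: reduction by the common
# divisor and the flip to the complementary divisor, (12.8)–(12.12)

[FI, §12, proof of Proposition 12.1, pp. 50–51 of arXiv:math/9811185 = Ann. of Math. (2) 148 (1998),
945–1040].  "The remaining points contribute
`V(f,g) = ∑_d f(d) ∑∑_{r₁s₂ ≡ r₂s₁ (mod d)} α_{r₁s₁} ᾱ_{r₂s₂} (d/(r₁r₂)) g(|s₁/r₁ − s₂/r₂|)`.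
We reduce the variables `r₁, r₂` by the common divisor `c = (r₁, r₂)` and remove the resulting
condition `(c, d) = 1` by Möbius inversion getting (12.8) `V(f,g) = ∑_c ∑_{m|c} μ(m) V_{cm}(f,g)` where
`V_{cm}(f,g)` is the sum (12.9)
`∑_d f(dm) ∑∑_{r₁s₂ ≡ r₂s₁ (dm), (r₁,r₂)=1} α_{cr₁s₁} ᾱ_{cr₂s₂} (dm/(r₁r₂)) g(c⁻¹|s₁/r₁ − s₂/r₂|)`.
For every `c` and `m | c` we estimate `V_{cm}(f,g)` separately.  Here we flip `d` to the complementary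
divisor of `|r₁s₂ − r₂s₁| m⁻¹`.  We write `|r₁s₂ − r₂s₁| = dmq` and interpret each and every term
involving `d` in terms of `q`.  We have `f(dm) = f(|s₁/r₁ − s₂/r₂| r₁r₂/q)` and using the reciprocity
law we get (recall that `r₁, r₂` are co-prime, odd, and congruent modulo eight)
`(dm/(r₁r₂)) = (s₁/r₁)(s₂/r₂)(q/(r₁r₂))`.  This transforms `V_{cm}(f,g)` into the sum (12.10)
`∑_q ∑∑_{r₁s₂ ≡ r₂s₁ (mq), (r₁,r₂)=1} β_{r₁s₁} β̄_{r₂s₂} (q/(r₁r₂)) B(c⁻¹(s₁/r₁ − s₂/r₂), cr₁r₂/q)`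
where (12.11) `B(x,y) = f(|x|y) g(|x|)` and `β_{rs} = (s/r) α_{crs}`."

This file PROVES the two identities, as exact equalities of finite sums with an arbitrary weight
`w(d)` (FI: `f(d)`) and an arbitrary pair kernel (FI: `g(|s₁/r₁ − s₂/r₂|)` times `α_{r₁s₁}ᾱ_{r₂s₂}`),
in the tree's box encoding (`R < r ≤ 2R`, `S < s ≤ 2S`; reduced boxes `R/c < r ≤ 2R/c` as in
`exists_prop111Star_mixed`):

* `sum_ne_eq_sum_gcd_moebius` — (12.8)–(12.9): the pairs `r₁ ≠ r₂` of
  `∑_d w(d) ∑∑_{d ∣ r₁s₂−r₂s₁} (d/(r₁r₂)) Φ(r₁,s₁,r₂,s₂)` regrouped by `c = (r₁,r₂) ≤ R`, `m | c`: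
  `= ∑_{c ≤ R} ∑_{m|c} μ(m) ∑_d w(dm) ∑∑_{dm ∣ r₁s₂−r₂s₁, (r₁,r₂)=1} (dm/(r₁r₂)) Φ(cr₁,s₁,cr₂,s₂)`
  (the pairs with `r₁ = r₂`, i.e. `c > R`, are kept apart: on the dyadic box they are exactly the
  pairs with `(r₁, r₂) > R`, and Proposition 11.1* needs `R/c ≥ 1`);
* `sum_dvd_mul_eq_sum_complementary` — (12.10)–(12.11): for `α_{rs}` supported on `(r, 2s) = 1` with
  `r` in one class modulo `4`, `c` odd, `m ≥ 1`, the flip `d ↦ q = |r₁s₂ − r₂s₁|/(dm)` turns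
  `∑_d w(dm) ∑∑_{dm ∣ Δ, (r₁,r₂)=1} (dm/(r₁r₂)) α_{cr₁s₁}ᾱ_{cr₂s₂} G` into
  `∑_q ∑∑_{qm ∣ Δ, (r₁,r₂)=1} β_{r₁s₁} β̄_{r₂s₂} (q/(r₁r₂)) w(|Δ|/q) G`, `β_{rs} = [(r,m)=1](s/r)α_{crs}`,
  `Δ = r₁s₂ − r₂s₁`, for any pair kernel `G` vanishing on the diagonal `Δ = 0` (FI's `g`, which
  vanishes near `0`).  The symbol identity is the tree's `jacobiSym_complementary_divisor`; the
  support restriction `(r, m) = 1` is forced by `(dm/(r₁r₂)) = 0` otherwise (cf. the proof of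
  Proposition 11.1*, "note that `(r₁r₂, m) = 1`").

The `q`-range (12.12) is not imposed here (any range `q ≤ L`, `L ≥ 4RS`, carries all the terms); it is
read off from the supports of `f` and `g` where the kernel `B` is separated ((12.13)–(12.14):
`…SmoothMajorantMellinKernel`, `…CutoffFourierKernel`).  No definitions, no named facts; steps 4–5 of
HOME/parity-ideate-lit/FI98-Prop121-MAP.md.

## References

* J. Friedlander, H. Iwaniec, *The polynomial `X² + Y⁴` captures its primes*, Ann. of Math. (2) 148
  (1998), 945–1040, §12, (12.8)–(12.12). [FriedlanderIwaniecAnnals1998]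

## Tree / Mathlib

Tree: `jacobiSym_complementary_divisor` (`…JacobiTwistedFlip`), `ite_coprime_eq_sum_filter_moebius`,
`filter_dvd_Ioc_eq_image` (`…JacobiTwistedLemmas`). Mathlib: `jacobiSym.mul_right'`, `jacobiSym.sq_one`,
`jacobiSym.eq_zero_iff`, `Nat.gcd_div`, `Nat.coprime_div_gcd_div_gcd`, `Finset.sum_nbij'`.
-/

noncomputable section

open Finset Real Complex
open scoped NumberTheorySymbols ArithmeticFunction.Moebius Nat ComplexConjugate

namespace Literature.NumberTheory.Sieve.FriedlanderIwaniecPrimes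

/-! ### Summation plumbing -/

/-- Moving an innermost fifth sum outside four others. [folklore] -/
private theorem sum_comm₄ (A₁ A₂ A₃ A₄ C : Finset ℕ) (f : ℕ → ℕ → ℕ → ℕ → ℕ → ℂ) :
    ∑ a₁ ∈ A₁, ∑ a₂ ∈ A₂, ∑ a₃ ∈ A₃, ∑ a₄ ∈ A₄, ∑ c ∈ C, f a₁ a₂ a₃ a₄ c =
      ∑ c ∈ C, ∑ a₁ ∈ A₁, ∑ a₂ ∈ A₂, ∑ a₃ ∈ A₃, ∑ a₄ ∈ A₄, f a₁ a₂ a₃ a₄ c := by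
  calc ∑ a₁ ∈ A₁, ∑ a₂ ∈ A₂, ∑ a₃ ∈ A₃, ∑ a₄ ∈ A₄, ∑ c ∈ C, f a₁ a₂ a₃ a₄ c
      = ∑ a₁ ∈ A₁, ∑ a₂ ∈ A₂, ∑ a₃ ∈ A₃, ∑ c ∈ C, ∑ a₄ ∈ A₄, f a₁ a₂ a₃ a₄ c := by
        refine sum_congr rfl fun _ _ => sum_congr rfl fun _ _ => sum_congr rfl fun _ _ => ?_
        exact sum_comm
    _ = ∑ a₁ ∈ A₁, ∑ a₂ ∈ A₂, ∑ c ∈ C, ∑ a₃ ∈ A₃, ∑ a₄ ∈ A₄, f a₁ a₂ a₃ a₄ c := by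
        refine sum_congr rfl fun _ _ => sum_congr rfl fun _ _ => ?_
        exact sum_comm
    _ = ∑ a₁ ∈ A₁, ∑ c ∈ C, ∑ a₂ ∈ A₂, ∑ a₃ ∈ A₃, ∑ a₄ ∈ A₄, f a₁ a₂ a₃ a₄ c := by
        refine sum_congr rfl fun _ _ => ?_
        exact sum_comm
    _ = ∑ c ∈ C, ∑ a₁ ∈ A₁, ∑ a₂ ∈ A₂, ∑ a₃ ∈ A₃, ∑ a₄ ∈ A₄, f a₁ a₂ a₃ a₄ c := sum_comm

/-- Summing over the multiples of `g ≥ 1` in `(A, B]`: substitute `n = g t`, `t ∈ (A/g, B/g]`.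
[folklore] -/
private theorem sum_Ioc_ite_dvd {g : ℕ} (hg : 0 < g) (A B : ℕ) (X : ℕ → ℂ) :
    ∑ n ∈ Ioc A B, (if g ∣ n then X n else 0) = ∑ t ∈ Ioc (A / g) (B / g), X (g * t) := by
  rw [← sum_filter, filter_dvd_Ioc_eq_image hg, sum_image]
  intro t₁ _ t₂ _ h
  exact Nat.eq_of_mul_eq_mul_left hg h

/-- The same with the product written `t g`. [folklore] -/
private theorem sum_Ioc_ite_dvd' {g : ℕ} (hg : 0 < g) (A B : ℕ) (X : ℕ → ℂ) :
    ∑ n ∈ Ioc A B, (if g ∣ n then X n else 0) = ∑ t ∈ Ioc (A / g) (B / g), X (t * g) := by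
  rw [sum_Ioc_ite_dvd hg]
  simp_rw [mul_comm g]

/-- **Reducing a pair of variables by a common divisor**: substitute `r₁ = c t₁`, `r₂ = c t₂` in a
double box sum restricted to `c ∣ r₁`, `c ∣ r₂` ("We reduce the variables `r₁, r₂` by the common
divisor `c = (r₁, r₂)`"). [cite: FriedlanderIwaniecAnnals1998, §12, (12.8)–(12.9)] -/
theorem sum_ite_dvd_dvd_eq_sum_mul {c : ℕ} (hc : 0 < c) (A B : ℕ) (T : Finset ℕ)
    (G : ℕ → ℕ → ℕ → ℕ → ℂ) :
    ∑ r₁ ∈ Ioc A B, ∑ s₁ ∈ T, ∑ r₂ ∈ Ioc A B, ∑ s₂ ∈ T,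
        (if c ∣ r₁ ∧ c ∣ r₂ then G r₁ s₁ r₂ s₂ else 0) =
      ∑ t₁ ∈ Ioc (A / c) (B / c), ∑ s₁ ∈ T, ∑ t₂ ∈ Ioc (A / c) (B / c), ∑ s₂ ∈ T,
        G (c * t₁) s₁ (c * t₂) s₂ := by
  have hinner : ∀ r₁ : ℕ, ∀ s₁ : ℕ, ∑ r₂ ∈ Ioc A B, ∑ s₂ ∈ T,
      (if c ∣ r₁ ∧ c ∣ r₂ then G r₁ s₁ r₂ s₂ else 0) =
      if c ∣ r₁ then ∑ t₂ ∈ Ioc (A / c) (B / c), ∑ s₂ ∈ T, G r₁ s₁ (c * t₂) s₂ else 0 := by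
    intro r₁ s₁
    by_cases h₁ : c ∣ r₁
    · rw [if_pos h₁]
      refine Eq.trans ?_ (sum_Ioc_ite_dvd hc A B (fun r₂ => ∑ s₂ ∈ T, G r₁ s₁ r₂ s₂))
      refine sum_congr rfl fun r₂ _ => ?_
      by_cases h₂ : c ∣ r₂
      · rw [if_pos h₂]
        exact sum_congr rfl fun s₂ _ => if_pos ⟨h₁, h₂⟩
      · rw [if_neg h₂]
        exact sum_eq_zero fun s₂ _ => if_neg fun h => h₂ h.2
    · rw [if_neg h₁]
      exact sum_eq_zero fun r₂ _ => sum_eq_zero fun s₂ _ => if_neg fun h => h₁ h.1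
  simp_rw [hinner]
  have houter : ∀ s₁ : ℕ, ∑ r₁ ∈ Ioc A B,
      (if c ∣ r₁ then ∑ t₂ ∈ Ioc (A / c) (B / c), ∑ s₂ ∈ T, G r₁ s₁ (c * t₂) s₂ else 0) =
      ∑ t₁ ∈ Ioc (A / c) (B / c), ∑ t₂ ∈ Ioc (A / c) (B / c), ∑ s₂ ∈ T, G (c * t₁) s₁ (c * t₂) s₂ :=
    fun s₁ => sum_Ioc_ite_dvd hc A B _
  rw [sum_comm]
  simp_rw [houter]
  rw [sum_comm]

/-! ### (12.8)–(12.9): reduction by `c = (r₁, r₂)` and Möbius inversion in `(c, d) = 1` -/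

/-- On the dyadic box, `c = (r₁, r₂) ≤ R` exactly when `r₁ ≠ r₂`; the indicator of `r₁ ≠ r₂` expands
as `∑_{c ≤ R} [c ∣ r₁, c ∣ r₂, (r₁/c, r₂/c) = 1]`. [cite: FriedlanderIwaniecAnnals1998, §12, (12.8)] -/
theorem ite_ne_eq_sum_ite_dvd {R r₁ r₂ : ℕ} (hr₁ : r₁ ∈ Ioc R (2 * R)) (hr₂ : r₂ ∈ Ioc R (2 * R))
    (x : ℂ) :
    (if r₁ ≠ r₂ then x else 0) =
      ∑ c ∈ Icc 1 R, (if c ∣ r₁ ∧ c ∣ r₂ then (if (r₁ / c).Coprime (r₂ / c) then x else 0) else 0) := by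
  have hr₁0 : 0 < r₁ := lt_of_le_of_lt (Nat.zero_le R) (mem_Ioc.mp hr₁).1
  set g := Nat.gcd r₁ r₂ with hgdef
  have hg0 : 0 < g := Nat.gcd_pos_of_pos_left _ hr₁0
  -- a common divisor with coprime quotients is the gcd
  have hkey : ∀ c : ℕ, c ∣ r₁ → c ∣ r₂ → (r₁ / c).Coprime (r₂ / c) → c = g := by
    intro c h1 h2 h3
    have hc0 : 0 < c := Nat.pos_of_dvd_of_pos h1 hr₁0
    have h4 := Nat.gcd_div h1 h2
    rw [Nat.Coprime] at h3
    rw [h3, ← hgdef] at h4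
    have h5 : c ∣ g := Nat.dvd_gcd h1 h2
    obtain ⟨k, hk⟩ := h5
    rw [hk, Nat.mul_div_cancel_left _ hc0] at h4
    rw [hk, ← h4, mul_one]
  by_cases hne : r₁ ≠ r₂
  · rw [if_pos hne]
    -- `g ≤ R`
    have hgR : g ≤ R := by
      by_contra hlt'
      have hlt : R < g := not_le.mp hlt'
      obtain ⟨k₁, hk₁⟩ := Nat.gcd_dvd_left r₁ r₂
      obtain ⟨k₂, hk₂⟩ := Nat.gcd_dvd_right r₁ r₂
      rw [← hgdef] at hk₁ hk₂
      have h1 := (mem_Ioc.mp hr₁).2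
      have h2 := (mem_Ioc.mp hr₂).2
      have hk₁1 : k₁ = 1 := by
        rcases Nat.eq_zero_or_pos k₁ with h | h
        · exfalso; rw [h, mul_zero] at hk₁; omega
        · by_contra hk
          have : 2 ≤ k₁ := by omega
          have : g * 2 ≤ g * k₁ := Nat.mul_le_mul_left _ this
          omega
      have hk₂1 : k₂ = 1 := by
        rcases Nat.eq_zero_or_pos k₂ with h | h
        · exfalso; rw [h, mul_zero] at hk₂
          have := (mem_Ioc.mp hr₂).1; omega
        · by_contra hk
          have : 2 ≤ k₂ := by omega
          have : g * 2 ≤ g * k₂ := Nat.mul_le_mul_left _ this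
          omega
      rw [hk₁1, mul_one] at hk₁
      rw [hk₂1, mul_one] at hk₂
      exact hne (hk₁.trans hk₂.symm)
    have hgmem : g ∈ Icc 1 R := mem_Icc.mpr ⟨hg0, hgR⟩
    rw [sum_eq_single_of_mem g hgmem]
    · rw [if_pos ⟨Nat.gcd_dvd_left _ _, Nat.gcd_dvd_right _ _⟩, if_pos]
      exact Nat.coprime_div_gcd_div_gcd hg0
    · intro c _ hcg
      split_ifs with h1 h2
      · exact absurd (hkey c h1.1 h1.2 h2) hcg
      · rfl
      · rfl
  · rw [if_neg hne]
    have hne' : r₁ = r₂ := not_ne_iff.mp hne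
    subst hne'
    refine (sum_eq_zero fun c hc => ?_).symm
    split_ifs with h1 h2
    · exfalso
      have hc0 : 0 < c := (mem_Icc.mp hc).1
      have h3 : r₁ / c = 1 := by
        have h := h2
        rw [Nat.Coprime, Nat.gcd_self] at h
        exact h
      have h4 : r₁ = c := by
        have := Nat.div_mul_cancel h1.1
        rw [h3, one_mul] at this
        exact this.symm
      have := (mem_Ioc.mp hr₁).1
      have := (mem_Icc.mp hc).2
      omega
    · rfl
    · rfl

/-- Termwise Möbius step: for `c, d ≥ 1`, `t₁, t₂ ≥ 1`,
`[d ∣ c(t₁s₂ − t₂s₁)] (d/(ct₁·ct₂)) = ∑_{m | c, m | d} μ(m) · [d ∣ t₁s₂ − t₂s₁] (d/(t₁t₂))`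
("remove the resulting condition `(c, d) = 1` by Möbius inversion"; for `(c,d) > 1` the symbol
`(d/(c²t₁t₂))` vanishes). [cite: FriedlanderIwaniecAnnals1998, §12, (12.8)] -/
theorem ite_dvd_mul_jacobiSym_eq_sum_moebius {c d t₁ t₂ : ℕ} (hc : 0 < c)
    (ht₁ : 0 < t₁) (ht₂ : 0 < t₂) (s₁ s₂ : ℕ) (P : Prop) [Decidable P] (x : ℂ) :
    (if P ∧ (d : ℤ) ∣ ((c * t₁ : ℕ) : ℤ) * s₂ - ((c * t₂ : ℕ) : ℤ) * s₁ then
        (J((d : ℤ) | c * t₁ * (c * t₂)) : ℂ) * x else 0) =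
      ∑ m ∈ c.divisors, (if m ∣ d then
        (μ m : ℂ) * (if (d : ℤ) ∣ (t₁ : ℤ) * s₂ - (t₂ : ℤ) * s₁ ∧ P then
          (J((d : ℤ) | t₁ * t₂) : ℂ) * x else 0) else 0) := by
  -- the Möbius sum is the indicator of `(d, c) = 1`
  have hμ : ∑ m ∈ c.divisors, (if m ∣ d then
        (μ m : ℂ) * (if (d : ℤ) ∣ (t₁ : ℤ) * s₂ - (t₂ : ℤ) * s₁ ∧ P then
          (J((d : ℤ) | t₁ * t₂) : ℂ) * x else 0) else 0) =
      (if d.Coprime c then (1 : ℂ) else 0) *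
        (if (d : ℤ) ∣ (t₁ : ℤ) * s₂ - (t₂ : ℤ) * s₁ ∧ P then (J((d : ℤ) | t₁ * t₂) : ℂ) * x else 0) := by
    rw [ite_coprime_eq_sum_filter_moebius d hc.ne', sum_filter, sum_mul]
    refine sum_congr rfl fun m _ => ?_
    split_ifs <;> simp
  rw [hμ]
  have hΔ : ((c * t₁ : ℕ) : ℤ) * s₂ - ((c * t₂ : ℕ) : ℤ) * s₁ = (c : ℤ) * ((t₁ : ℤ) * s₂ - (t₂ : ℤ) * s₁) := by
    push_cast; ring
  by_cases hcop : d.Coprime c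
  · -- `(d/(c t₁ · c t₂)) = (d/c)² (d/(t₁t₂)) = (d/(t₁t₂))`, and `d ∣ cΔ ⟺ d ∣ Δ`
    rw [if_pos hcop, one_mul]
    have hJ : J((d : ℤ) | c * t₁ * (c * t₂)) = J((d : ℤ) | t₁ * t₂) := by
      have hct : c * t₁ * (c * t₂) = (c * c) * (t₁ * t₂) := by ring
      rw [hct, jacobiSym.mul_right' _ (Nat.mul_pos hc hc).ne' (Nat.mul_pos ht₁ ht₂).ne',
        jacobiSym.mul_right' _ hc.ne' hc.ne', ← sq]
      have hg : ((d : ℤ)).gcd (c : ℤ) = 1 := by rw [Int.gcd_natCast_natCast]; exact hcop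
      rw [jacobiSym.sq_one hg, one_mul]
    have hdvd : (d : ℤ) ∣ ((c * t₁ : ℕ) : ℤ) * s₂ - ((c * t₂ : ℕ) : ℤ) * s₁ ↔
        (d : ℤ) ∣ (t₁ : ℤ) * s₂ - (t₂ : ℤ) * s₁ := by
      rw [hΔ]
      constructor
      · intro h
        have hg : Int.gcd (d : ℤ) (c : ℤ) = 1 := by rw [Int.gcd_natCast_natCast]; exact hcop
        exact Int.dvd_of_dvd_mul_right_of_gcd_one h hg
      · intro h
        exact h.mul_left _
    rw [hJ]
    by_cases h : (d : ℤ) ∣ (t₁ : ℤ) * s₂ - (t₂ : ℤ) * s₁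
    · by_cases hP : P
      · rw [if_pos ⟨hP, hdvd.mpr h⟩, if_pos ⟨h, hP⟩]
      · rw [if_neg (fun h' => hP h'.1), if_neg (fun h' => hP h'.2)]
    · rw [if_neg (fun h' => h (hdvd.mp h'.2)), if_neg (fun h' => h h'.1)]
  · -- `(d, c) > 1`: the symbol vanishes
    rw [if_neg hcop, zero_mul]
    split_ifs with h
    · have hJ : J((d : ℤ) | c * t₁ * (c * t₂)) = 0 := by
        rw [jacobiSym.eq_zero_iff]
        refine ⟨(Nat.mul_pos (Nat.mul_pos hc ht₁) (Nat.mul_pos hc ht₂)).ne', fun hg => hcop ?_⟩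
        rw [Int.gcd_natCast_natCast] at hg
        exact Nat.Coprime.coprime_dvd_right ⟨t₁ * (c * t₂), by ring⟩ hg
      rw [hJ, Int.cast_zero, zero_mul]
    · rfl

/-- **(12.8)–(12.9)** [FI, §12]: for any weight `w` vanishing beyond `N` and any pair function `Φ`,
the pairs `r₁ ≠ r₂` of `∑_{d ≤ N} w(d) ∑∑_{d ∣ r₁s₂ − r₂s₁} (d/(r₁r₂)) Φ(r₁,s₁,r₂,s₂)` over the box
`R < rᵢ ≤ 2R`, `S < sᵢ ≤ 2S` regroup as
`∑_{c ≤ R} ∑_{m|c} μ(m) ∑_{d ≤ N} w(dm) ∑∑_{R/c < tᵢ ≤ 2R/c, dm ∣ t₁s₂ − t₂s₁, (t₁,t₂)=1} (dm/(t₁t₂)) Φ(ct₁,s₁,ct₂,s₂)`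
("We reduce the variables `r₁, r₂` by the common divisor `c = (r₁,r₂)` and remove the resulting
condition `(c, d) = 1` by Möbius inversion getting `V(f,g) = ∑_c ∑_{m|c} μ(m) V_{cm}(f,g)`").
The diagonal pairs `r₁ = r₂` (`c = r₁ > R`) are excluded on both sides.
[cite: FriedlanderIwaniecAnnals1998, §12, (12.8)–(12.9)] -/
theorem sum_ne_eq_sum_gcd_moebius (R S N : ℕ) (w : ℕ → ℂ) (hw : ∀ d, N < d → w d = 0)
    (Φ : ℕ → ℕ → ℕ → ℕ → ℂ) :
    ∑ d ∈ Ioc 0 N, w d * ∑ r₁ ∈ Ioc R (2 * R), ∑ s₁ ∈ Ioc S (2 * S), ∑ r₂ ∈ Ioc R (2 * R),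
        ∑ s₂ ∈ Ioc S (2 * S),
        (if r₁ ≠ r₂ ∧ (d : ℤ) ∣ (r₁ : ℤ) * s₂ - (r₂ : ℤ) * s₁ then
          (J((d : ℤ) | r₁ * r₂) : ℂ) * Φ r₁ s₁ r₂ s₂ else 0) =
      ∑ c ∈ Icc 1 R, ∑ m ∈ c.divisors, (μ m : ℂ) * ∑ d ∈ Ioc 0 N, w (d * m) *
        ∑ t₁ ∈ Ioc (R / c) (2 * R / c), ∑ s₁ ∈ Ioc S (2 * S), ∑ t₂ ∈ Ioc (R / c) (2 * R / c),
          ∑ s₂ ∈ Ioc S (2 * S),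
          (if ((d * m : ℕ) : ℤ) ∣ (t₁ : ℤ) * s₂ - (t₂ : ℤ) * s₁ ∧ t₁.Coprime t₂ then
            (J(((d * m : ℕ) : ℤ) | t₁ * t₂) : ℂ) * Φ (c * t₁) s₁ (c * t₂) s₂ else 0) := by
  set IR := Ioc R (2 * R) with hIR
  set IS := Ioc S (2 * S) with hIS
  -- Step A: `[r₁ ≠ r₂]` as a sum over `c`, then `r = c t`
  have hA : ∀ d : ℕ, ∑ r₁ ∈ IR, ∑ s₁ ∈ IS, ∑ r₂ ∈ IR, ∑ s₂ ∈ IS,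
      (if r₁ ≠ r₂ ∧ (d : ℤ) ∣ (r₁ : ℤ) * s₂ - (r₂ : ℤ) * s₁ then
        (J((d : ℤ) | r₁ * r₂) : ℂ) * Φ r₁ s₁ r₂ s₂ else 0) =
      ∑ c ∈ Icc 1 R, ∑ t₁ ∈ Ioc (R / c) (2 * R / c), ∑ s₁ ∈ IS, ∑ t₂ ∈ Ioc (R / c) (2 * R / c),
        ∑ s₂ ∈ IS,
        (if t₁.Coprime t₂ ∧ (d : ℤ) ∣ ((c * t₁ : ℕ) : ℤ) * s₂ - ((c * t₂ : ℕ) : ℤ) * s₁ then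
          (J((d : ℤ) | c * t₁ * (c * t₂)) : ℂ) * Φ (c * t₁) s₁ (c * t₂) s₂ else 0) := by
    intro d
    have h1 : ∀ r₁ ∈ IR, ∀ s₁ ∈ IS, ∀ r₂ ∈ IR, ∀ s₂ ∈ IS,
        (if r₁ ≠ r₂ ∧ (d : ℤ) ∣ (r₁ : ℤ) * s₂ - (r₂ : ℤ) * s₁ then
          (J((d : ℤ) | r₁ * r₂) : ℂ) * Φ r₁ s₁ r₂ s₂ else 0) =
        ∑ c ∈ Icc 1 R, (if c ∣ r₁ ∧ c ∣ r₂ then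
          (if (r₁ / c).Coprime (r₂ / c) ∧ (d : ℤ) ∣ (r₁ : ℤ) * s₂ - (r₂ : ℤ) * s₁ then
            (J((d : ℤ) | r₁ * r₂) : ℂ) * Φ r₁ s₁ r₂ s₂ else 0) else 0) := by
      intro r₁ hr₁ s₁ _ r₂ hr₂ s₂ _
      rw [ite_and, ite_ne_eq_sum_ite_dvd hr₁ hr₂]
      simp only [ite_and]
    calc ∑ r₁ ∈ IR, ∑ s₁ ∈ IS, ∑ r₂ ∈ IR, ∑ s₂ ∈ IS,
          (if r₁ ≠ r₂ ∧ (d : ℤ) ∣ (r₁ : ℤ) * s₂ - (r₂ : ℤ) * s₁ then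
            (J((d : ℤ) | r₁ * r₂) : ℂ) * Φ r₁ s₁ r₂ s₂ else 0)
        = ∑ r₁ ∈ IR, ∑ s₁ ∈ IS, ∑ r₂ ∈ IR, ∑ s₂ ∈ IS, ∑ c ∈ Icc 1 R, (if c ∣ r₁ ∧ c ∣ r₂ then
            (if (r₁ / c).Coprime (r₂ / c) ∧ (d : ℤ) ∣ (r₁ : ℤ) * s₂ - (r₂ : ℤ) * s₁ then
              (J((d : ℤ) | r₁ * r₂) : ℂ) * Φ r₁ s₁ r₂ s₂ else 0) else 0) := by
          refine sum_congr rfl fun r₁ hr₁ => sum_congr rfl fun s₁ hs₁ => sum_congr rfl fun r₂ hr₂ =>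
            sum_congr rfl fun s₂ hs₂ => h1 r₁ hr₁ s₁ hs₁ r₂ hr₂ s₂ hs₂
      _ = ∑ c ∈ Icc 1 R, ∑ r₁ ∈ IR, ∑ s₁ ∈ IS, ∑ r₂ ∈ IR, ∑ s₂ ∈ IS, (if c ∣ r₁ ∧ c ∣ r₂ then
            (if (r₁ / c).Coprime (r₂ / c) ∧ (d : ℤ) ∣ (r₁ : ℤ) * s₂ - (r₂ : ℤ) * s₁ then
              (J((d : ℤ) | r₁ * r₂) : ℂ) * Φ r₁ s₁ r₂ s₂ else 0) else 0) := sum_comm₄ _ _ _ _ _ _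
      _ = _ := by
          refine sum_congr rfl fun c hc => ?_
          have hc0 : 0 < c := (mem_Icc.mp hc).1
          rw [hIR, sum_ite_dvd_dvd_eq_sum_mul hc0]
          simp_rw [Nat.mul_div_cancel_left _ hc0]
  -- Step B: the Möbius expansion, termwise, and the reorganisation of the sums
  have hB : ∀ c ∈ Icc 1 R, ∀ d ∈ Ioc 0 N,
      ∑ t₁ ∈ Ioc (R / c) (2 * R / c), ∑ s₁ ∈ IS, ∑ t₂ ∈ Ioc (R / c) (2 * R / c), ∑ s₂ ∈ IS,
        (if t₁.Coprime t₂ ∧ (d : ℤ) ∣ ((c * t₁ : ℕ) : ℤ) * s₂ - ((c * t₂ : ℕ) : ℤ) * s₁ then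
          (J((d : ℤ) | c * t₁ * (c * t₂)) : ℂ) * Φ (c * t₁) s₁ (c * t₂) s₂ else 0) =
      ∑ m ∈ c.divisors, ∑ t₁ ∈ Ioc (R / c) (2 * R / c), ∑ s₁ ∈ IS, ∑ t₂ ∈ Ioc (R / c) (2 * R / c),
        ∑ s₂ ∈ IS, (if m ∣ d then (μ m : ℂ) *
          (if (d : ℤ) ∣ (t₁ : ℤ) * s₂ - (t₂ : ℤ) * s₁ ∧ t₁.Coprime t₂ then
            (J((d : ℤ) | t₁ * t₂) : ℂ) * Φ (c * t₁) s₁ (c * t₂) s₂ else 0) else 0) := by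
    intro c hc d _
    have hc0 : 0 < c := (mem_Icc.mp hc).1
    rw [← sum_comm₄]
    refine sum_congr rfl fun t₁ ht₁ => sum_congr rfl fun s₁ _ => sum_congr rfl fun t₂ ht₂ =>
      sum_congr rfl fun s₂ _ => ?_
    have ht₁0 : 0 < t₁ := lt_of_le_of_lt (Nat.zero_le _) (mem_Ioc.mp ht₁).1
    have ht₂0 : 0 < t₂ := lt_of_le_of_lt (Nat.zero_le _) (mem_Ioc.mp ht₂).1
    exact ite_dvd_mul_jacobiSym_eq_sum_moebius hc0 ht₁0 ht₂0 s₁ s₂ _ _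
  -- Step C: for fixed `c` and `m | c`, reindex `d = d' m`
  have hC : ∀ c ∈ Icc 1 R, ∀ m ∈ c.divisors,
      ∑ d ∈ Ioc 0 N, w d * ∑ t₁ ∈ Ioc (R / c) (2 * R / c), ∑ s₁ ∈ IS,
        ∑ t₂ ∈ Ioc (R / c) (2 * R / c), ∑ s₂ ∈ IS, (if m ∣ d then (μ m : ℂ) *
          (if (d : ℤ) ∣ (t₁ : ℤ) * s₂ - (t₂ : ℤ) * s₁ ∧ t₁.Coprime t₂ then
            (J((d : ℤ) | t₁ * t₂) : ℂ) * Φ (c * t₁) s₁ (c * t₂) s₂ else 0) else 0) =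
      (μ m : ℂ) * ∑ d ∈ Ioc 0 N, w (d * m) *
        ∑ t₁ ∈ Ioc (R / c) (2 * R / c), ∑ s₁ ∈ IS, ∑ t₂ ∈ Ioc (R / c) (2 * R / c), ∑ s₂ ∈ IS,
          (if ((d * m : ℕ) : ℤ) ∣ (t₁ : ℤ) * s₂ - (t₂ : ℤ) * s₁ ∧ t₁.Coprime t₂ then
            (J(((d * m : ℕ) : ℤ) | t₁ * t₂) : ℂ) * Φ (c * t₁) s₁ (c * t₂) s₂ else 0) := by
    intro c _ m hm
    have hm0 : 0 < m := Nat.pos_of_mem_divisors hm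
    -- pull the indicator `m ∣ d` out of the inner sums
    have h1 : ∀ d : ℕ, w d * ∑ t₁ ∈ Ioc (R / c) (2 * R / c), ∑ s₁ ∈ IS,
        ∑ t₂ ∈ Ioc (R / c) (2 * R / c), ∑ s₂ ∈ IS, (if m ∣ d then (μ m : ℂ) *
          (if (d : ℤ) ∣ (t₁ : ℤ) * s₂ - (t₂ : ℤ) * s₁ ∧ t₁.Coprime t₂ then
            (J((d : ℤ) | t₁ * t₂) : ℂ) * Φ (c * t₁) s₁ (c * t₂) s₂ else 0) else 0) =
        if m ∣ d then (μ m : ℂ) * (w d * ∑ t₁ ∈ Ioc (R / c) (2 * R / c), ∑ s₁ ∈ IS,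
          ∑ t₂ ∈ Ioc (R / c) (2 * R / c), ∑ s₂ ∈ IS,
          (if (d : ℤ) ∣ (t₁ : ℤ) * s₂ - (t₂ : ℤ) * s₁ ∧ t₁.Coprime t₂ then
            (J((d : ℤ) | t₁ * t₂) : ℂ) * Φ (c * t₁) s₁ (c * t₂) s₂ else 0)) else 0 := by
      intro d
      by_cases hmd : m ∣ d
      · simp only [if_pos hmd]
        rw [mul_left_comm]
        congr 1
        simp_rw [mul_sum]
      · simp only [if_neg hmd, sum_const_zero, mul_zero]
    simp_rw [h1]
    rw [sum_Ioc_ite_dvd' hm0 0 N, Nat.zero_div, mul_sum]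
    -- extend the range `d' ≤ N/m` to `d' ≤ N` (the added terms have `w(d'm) = 0`)
    refine sum_subset (Ioc_subset_Ioc_right (Nat.div_le_self N m)) fun d' hd' hd'N => ?_
    have hlt : N / m < d' := by
      rw [mem_Ioc, not_and] at hd'N
      have h0 : 0 < d' := (mem_Ioc.mp hd').1
      exact not_le.mp (hd'N h0)
    have hwz : w (d' * m) = 0 := hw _ ((Nat.div_lt_iff_lt_mul hm0).mp hlt)
    rw [hwz, zero_mul, mul_zero]
  -- assemble
  calc ∑ d ∈ Ioc 0 N, w d * ∑ r₁ ∈ IR, ∑ s₁ ∈ IS, ∑ r₂ ∈ IR, ∑ s₂ ∈ IS,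
          (if r₁ ≠ r₂ ∧ (d : ℤ) ∣ (r₁ : ℤ) * s₂ - (r₂ : ℤ) * s₁ then
            (J((d : ℤ) | r₁ * r₂) : ℂ) * Φ r₁ s₁ r₂ s₂ else 0)
      = ∑ d ∈ Ioc 0 N, ∑ c ∈ Icc 1 R, w d * ∑ t₁ ∈ Ioc (R / c) (2 * R / c), ∑ s₁ ∈ IS,
          ∑ t₂ ∈ Ioc (R / c) (2 * R / c), ∑ s₂ ∈ IS,
          (if t₁.Coprime t₂ ∧ (d : ℤ) ∣ ((c * t₁ : ℕ) : ℤ) * s₂ - ((c * t₂ : ℕ) : ℤ) * s₁ then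
            (J((d : ℤ) | c * t₁ * (c * t₂)) : ℂ) * Φ (c * t₁) s₁ (c * t₂) s₂ else 0) := by
          refine sum_congr rfl fun d _ => ?_
          rw [hA d, mul_sum]
    _ = ∑ c ∈ Icc 1 R, ∑ d ∈ Ioc 0 N, w d * ∑ t₁ ∈ Ioc (R / c) (2 * R / c), ∑ s₁ ∈ IS,
          ∑ t₂ ∈ Ioc (R / c) (2 * R / c), ∑ s₂ ∈ IS,
          (if t₁.Coprime t₂ ∧ (d : ℤ) ∣ ((c * t₁ : ℕ) : ℤ) * s₂ - ((c * t₂ : ℕ) : ℤ) * s₁ then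
            (J((d : ℤ) | c * t₁ * (c * t₂)) : ℂ) * Φ (c * t₁) s₁ (c * t₂) s₂ else 0) := sum_comm
    _ = ∑ c ∈ Icc 1 R, ∑ d ∈ Ioc 0 N, ∑ m ∈ c.divisors, w d *
          ∑ t₁ ∈ Ioc (R / c) (2 * R / c), ∑ s₁ ∈ IS, ∑ t₂ ∈ Ioc (R / c) (2 * R / c), ∑ s₂ ∈ IS,
          (if m ∣ d then (μ m : ℂ) *
            (if (d : ℤ) ∣ (t₁ : ℤ) * s₂ - (t₂ : ℤ) * s₁ ∧ t₁.Coprime t₂ then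
              (J((d : ℤ) | t₁ * t₂) : ℂ) * Φ (c * t₁) s₁ (c * t₂) s₂ else 0) else 0) := by
          refine sum_congr rfl fun c hc => sum_congr rfl fun d hd => ?_
          rw [hB c hc d hd, mul_sum]
    _ = ∑ c ∈ Icc 1 R, ∑ m ∈ c.divisors, ∑ d ∈ Ioc 0 N, w d *
          ∑ t₁ ∈ Ioc (R / c) (2 * R / c), ∑ s₁ ∈ IS, ∑ t₂ ∈ Ioc (R / c) (2 * R / c), ∑ s₂ ∈ IS,
          (if m ∣ d then (μ m : ℂ) *
            (if (d : ℤ) ∣ (t₁ : ℤ) * s₂ - (t₂ : ℤ) * s₁ ∧ t₁.Coprime t₂ then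
              (J((d : ℤ) | t₁ * t₂) : ℂ) * Φ (c * t₁) s₁ (c * t₂) s₂ else 0) else 0) := by
          refine sum_congr rfl fun c _ => ?_
          exact sum_comm
    _ = _ := by
          refine sum_congr rfl fun c hc => sum_congr rfl fun m hm => ?_
          exact hC c hc m hm

/-! ### (12.10)–(12.11): flipping `d` to the complementary divisor -/

/-- **The flip for one pair** [FI, §12, before (12.10)]: for odd coprime `t₁ ≡ t₂ (mod 4)` with
`(sᵢ, tᵢ) = 1`, `m ≥ 1` and `Δ = t₁s₂ − t₂s₁ ≠ 0`, `|Δ| ≤ L`, the substitution `|Δ| = dmq` gives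
`∑_{d ≤ L, dm ∣ Δ} w(dm) (dm/(t₁t₂)) = (s₁/t₁)(s₂/t₂) ∑_{q ≤ L, qm ∣ Δ} w(|Δ|/q) (q/(t₁t₂))`
("we write `|r₁s₂ − r₂s₁| = dmq` and interpret each and every term involving `d` in terms of `q` …
using the reciprocity law we get `(dm/(r₁r₂)) = (s₁/r₁)(s₂/r₂)(q/(r₁r₂))`").
[cite: FriedlanderIwaniecAnnals1998, §12, (12.10)] -/
theorem sum_ite_dvd_jacobiSym_eq_flip {t₁ s₁ t₂ s₂ m L : ℕ} (hm : 0 < m) (ht₁ : Odd t₁)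
    (ht₂ : Odd t₂) (hcop : t₁.Coprime t₂) (h4 : t₁ % 4 = t₂ % 4) (hs₁ : s₁.Coprime t₁)
    (hs₂ : s₂.Coprime t₂) (hΔ0 : (t₁ : ℤ) * s₂ - (t₂ : ℤ) * s₁ ≠ 0)
    (hΔL : ((t₁ : ℤ) * s₂ - (t₂ : ℤ) * s₁).natAbs ≤ L) (w : ℕ → ℂ) :
    ∑ d ∈ Ioc 0 L, (if ((d * m : ℕ) : ℤ) ∣ (t₁ : ℤ) * s₂ - (t₂ : ℤ) * s₁ then
        w (d * m) * (J(((d * m : ℕ) : ℤ) | t₁ * t₂) : ℂ) else 0) =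
      (J((s₁ : ℤ) | t₁) : ℂ) * (J((s₂ : ℤ) | t₂) : ℂ) *
        ∑ q ∈ Ioc 0 L, (if ((q * m : ℕ) : ℤ) ∣ (t₁ : ℤ) * s₂ - (t₂ : ℤ) * s₁ then
          w (((t₁ : ℤ) * s₂ - (t₂ : ℤ) * s₁).natAbs / q) * (J((q : ℤ) | t₁ * t₂) : ℂ) else 0) := by
  set Δ : ℤ := (t₁ : ℤ) * s₂ - (t₂ : ℤ) * s₁ with hΔ
  set n := Δ.natAbs with hn
  have hn0 : n ≠ 0 := Int.natAbs_ne_zero.mpr hΔ0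
  -- `dm ∣ Δ` with complementary divisor `q`: the basic facts
  have key : ∀ d : ℕ, 0 < d → ((d * m : ℕ) : ℤ) ∣ Δ →
      0 < n / (d * m) ∧ n / (d * m) ≤ L ∧ n = d * m * (n / (d * m)) ∧
        ((n / (d * m) * m : ℕ) : ℤ) ∣ Δ ∧ n / (n / (d * m) * m) = d := by
    intro d hd0 hdvd
    obtain ⟨q, hq⟩ : d * m ∣ n := Int.natCast_dvd.mp hdvd
    have hdm : 0 < d * m := Nat.mul_pos hd0 hm
    have hqv : n / (d * m) = q := by rw [hq, Nat.mul_div_cancel_left _ hdm]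
    have hq0 : 0 < q := by
      rcases Nat.eq_zero_or_pos q with h | h
      · rw [h, mul_zero] at hq; exact absurd hq hn0
      · exact h
    rw [hqv]
    refine ⟨hq0, ?_, hq, ?_, ?_⟩
    · calc q ≤ n := by rw [hq]; exact Nat.le_mul_of_pos_left q hdm
        _ ≤ L := hΔL
    · exact Int.natCast_dvd.mpr ⟨d, by rw [← hn, hq]; ring⟩
    · rw [hq, show d * m * q = (q * m) * d by ring, Nat.mul_div_cancel_left _ (Nat.mul_pos hq0 hm)]
  simp_rw [mul_sum, mul_ite, mul_zero]
  rw [← sum_filter, ← sum_filter]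
  refine sum_nbij' (fun d => n / (d * m)) (fun q => n / (q * m)) ?_ ?_ ?_ ?_ ?_
  · intro d hd
    rw [mem_filter, mem_Ioc] at hd
    obtain ⟨h1, h2, -, h4, -⟩ := key d hd.1.1 hd.2
    rw [mem_filter, mem_Ioc]
    exact ⟨⟨h1, h2⟩, h4⟩
  · intro q hq
    rw [mem_filter, mem_Ioc] at hq
    obtain ⟨h1, h2, -, h4, -⟩ := key q hq.1.1 hq.2
    rw [mem_filter, mem_Ioc]
    exact ⟨⟨h1, h2⟩, h4⟩
  · intro d hd
    rw [mem_filter, mem_Ioc] at hd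
    exact (key d hd.1.1 hd.2).2.2.2.2
  · intro q hq
    rw [mem_filter, mem_Ioc] at hq
    exact (key q hq.1.1 hq.2).2.2.2.2
  · intro d hd
    rw [mem_filter, mem_Ioc] at hd
    obtain ⟨hq0, -, hq, -, -⟩ := key d hd.1.1 hd.2
    set q := n / (d * m) with hqdef
    have hdm : 0 < d * m := Nat.mul_pos hd.1.1 hm
    have hnq : n / q = d * m := by
      rw [hq, show d * m * q = q * (d * m) by ring, Nat.mul_div_cancel_left _ hq0]
    -- the symbol identity
    have hN : t₁ * s₂ = t₂ * s₁ + d * m * q ∨ t₂ * s₁ = t₁ * s₂ + d * m * q := by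
      have hnz : (n : ℤ) = d * m * q := by exact_mod_cast hq
      rcases le_or_gt 0 Δ with hpos | hneg
      · left
        have h1 : (n : ℤ) = Δ := Int.natAbs_of_nonneg hpos
        have h2 : ((t₁ * s₂ : ℕ) : ℤ) = ((t₂ * s₁ + d * m * q : ℕ) : ℤ) := by
          push_cast
          rw [hΔ] at h1
          linarith
        exact_mod_cast h2
      · right
        have h1 : (n : ℤ) = -Δ := Int.ofNat_natAbs_of_nonpos hneg.le
        have h2 : ((t₂ * s₁ : ℕ) : ℤ) = ((t₁ * s₂ + d * m * q : ℕ) : ℤ) := by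
          push_cast
          rw [hΔ] at h1
          linarith
        exact_mod_cast h2
    have hJ := jacobiSym_complementary_divisor ht₁ ht₂ hcop h4 hs₁ hs₂ hN
    simp only [hnq, hJ]
    push_cast
    ring

/-- Coefficients supported on `(r, 2s) = 1`: `r` is odd and `(s, r) = 1`. [folklore] -/
private theorem odd_and_coprime_of_coprime_two_mul {r s : ℕ} (h : r.Coprime (2 * s)) :
    Odd r ∧ s.Coprime r := by
  refine ⟨?_, ?_⟩
  · exact Nat.coprime_two_right.mp (Nat.Coprime.coprime_dvd_right ⟨s, rfl⟩ h)
  · exact (Nat.Coprime.coprime_dvd_right ⟨2, by ring⟩ h).symm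

/-- **(12.10)–(12.11)** [FI, §12]: for `c` odd, `m ≥ 1`, `L ≥ 4RS`, a weight `w`, coefficients
`α_{rs}` supported on `(r, 2s) = 1` with all `r` in one class modulo `4`, and a pair kernel `G`
vanishing on the diagonal `t₁s₂ = t₂s₁`, flipping `d` to the complementary divisor
`q = |t₁s₂ − t₂s₁|/(dm)` gives
`∑_{d ≤ L} w(dm) ∑∑_{dm ∣ Δ, (t₁,t₂)=1} (dm/(t₁t₂)) α_{ct₁s₁} ᾱ_{ct₂s₂} G
   = ∑_{q ≤ L} ∑∑_{qm ∣ Δ, (t₁,t₂)=1} β_{t₁s₁} β̄_{t₂s₂} (q/(t₁t₂)) w(|Δ|/q) G`,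
`β_{ts} = [(t,m)=1] (s/t) α_{cts}`, `Δ = t₁s₂ − t₂s₁`, over the reduced boxes `R/c < tᵢ ≤ 2R/c`,
`S < sᵢ ≤ 2S` (with `w(d) = f(d)`, `G = g(|x|)`: `w(|Δ|/q) G = f(|x|y) g(|x|) = B(x,y)`,
`x = c⁻¹(s₁/t₁ − s₂/t₂)`, `y = ct₁t₂/q`, as in (12.11)).
[cite: FriedlanderIwaniecAnnals1998, §12, (12.10)–(12.11)] -/
theorem sum_dvd_mul_eq_sum_complementary {R S c m L : ℕ} (hc : Odd c) (hm : 0 < m)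
    (hL : 4 * R * S ≤ L) (w : ℕ → ℂ) (α : ℕ → ℕ → ℂ) (G : ℕ → ℕ → ℕ → ℕ → ℂ)
    (hα : ∀ r s, α r s ≠ 0 → r.Coprime (2 * s))
    (hα4 : ∀ r₁ s₁ r₂ s₂, α r₁ s₁ ≠ 0 → α r₂ s₂ ≠ 0 → r₁ % 4 = r₂ % 4)
    (hG : ∀ t₁ s₁ t₂ s₂ : ℕ, (t₁ : ℤ) * s₂ - (t₂ : ℤ) * s₁ = 0 → G t₁ s₁ t₂ s₂ = 0) :
    ∑ d ∈ Ioc 0 L, w (d * m) *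
        ∑ t₁ ∈ Ioc (R / c) (2 * R / c), ∑ s₁ ∈ Ioc S (2 * S), ∑ t₂ ∈ Ioc (R / c) (2 * R / c),
          ∑ s₂ ∈ Ioc S (2 * S),
          (if ((d * m : ℕ) : ℤ) ∣ (t₁ : ℤ) * s₂ - (t₂ : ℤ) * s₁ ∧ t₁.Coprime t₂ then
            (J(((d * m : ℕ) : ℤ) | t₁ * t₂) : ℂ) *
              (α (c * t₁) s₁ * conj (α (c * t₂) s₂) * G t₁ s₁ t₂ s₂) else 0) =
      ∑ q ∈ Ioc 0 L,
        ∑ t₁ ∈ Ioc (R / c) (2 * R / c), ∑ s₁ ∈ Ioc S (2 * S), ∑ t₂ ∈ Ioc (R / c) (2 * R / c),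
          ∑ s₂ ∈ Ioc S (2 * S),
          (if ((q * m : ℕ) : ℤ) ∣ (t₁ : ℤ) * s₂ - (t₂ : ℤ) * s₁ ∧ t₁.Coprime t₂ then
            (if t₁.Coprime m then (J((s₁ : ℤ) | t₁) : ℂ) * α (c * t₁) s₁ else 0) *
              conj (if t₂.Coprime m then (J((s₂ : ℤ) | t₂) : ℂ) * α (c * t₂) s₂ else 0) *
              (J((q : ℤ) | t₁ * t₂) : ℂ) *
              (w (((t₁ : ℤ) * s₂ - (t₂ : ℤ) * s₁).natAbs / q) * G t₁ s₁ t₂ s₂) else 0) := by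
  set IT := Ioc (R / c) (2 * R / c) with hIT
  set IS := Ioc S (2 * S) with hIS
  have hc0 : 0 < c := hc.pos
  -- move the `d`- and `q`-sums inside
  rw [show (∑ d ∈ Ioc 0 L, w (d * m) * ∑ t₁ ∈ IT, ∑ s₁ ∈ IS, ∑ t₂ ∈ IT, ∑ s₂ ∈ IS,
      (if ((d * m : ℕ) : ℤ) ∣ (t₁ : ℤ) * s₂ - (t₂ : ℤ) * s₁ ∧ t₁.Coprime t₂ then
        (J(((d * m : ℕ) : ℤ) | t₁ * t₂) : ℂ) * (α (c * t₁) s₁ * conj (α (c * t₂) s₂) * G t₁ s₁ t₂ s₂)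
        else 0)) =
      ∑ t₁ ∈ IT, ∑ s₁ ∈ IS, ∑ t₂ ∈ IT, ∑ s₂ ∈ IS, ∑ d ∈ Ioc 0 L, w (d * m) *
      (if ((d * m : ℕ) : ℤ) ∣ (t₁ : ℤ) * s₂ - (t₂ : ℤ) * s₁ ∧ t₁.Coprime t₂ then
        (J(((d * m : ℕ) : ℤ) | t₁ * t₂) : ℂ) * (α (c * t₁) s₁ * conj (α (c * t₂) s₂) * G t₁ s₁ t₂ s₂)
        else 0) by
    simp_rw [mul_sum]
    exact (sum_comm₄ IT IS IT IS (Ioc 0 L) _).symm]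
  rw [← sum_comm₄ IT IS IT IS (Ioc 0 L)]
  refine sum_congr rfl fun t₁ ht₁ => sum_congr rfl fun s₁ hs₁ => sum_congr rfl fun t₂ ht₂ =>
    sum_congr rfl fun s₂ hs₂ => ?_
  -- one pair `(t₁, s₁), (t₂, s₂)`
  set Δ : ℤ := (t₁ : ℤ) * s₂ - (t₂ : ℤ) * s₁ with hΔ
  by_cases hcop : t₁.Coprime t₂
  swap
  · rw [sum_eq_zero fun d _ => by rw [if_neg (fun h => hcop h.2), mul_zero],
      sum_eq_zero fun q _ => by rw [if_neg (fun h => hcop h.2)]]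
  by_cases hα₁ : α (c * t₁) s₁ = 0
  · rw [sum_eq_zero fun d _ => by rw [hα₁]; simp, sum_eq_zero fun q _ => by rw [hα₁]; simp]
  by_cases hα₂ : α (c * t₂) s₂ = 0
  · rw [sum_eq_zero fun d _ => by rw [hα₂]; simp, sum_eq_zero fun q _ => by rw [hα₂]; simp]
  by_cases hΔ0 : Δ = 0
  · have hG0 := hG t₁ s₁ t₂ s₂ hΔ0
    rw [sum_eq_zero fun d _ => by rw [hG0]; simp, sum_eq_zero fun q _ => by rw [hG0]; simp]
  by_cases hm' : t₁.Coprime m ∧ t₂.Coprime m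
  swap
  · -- `(t₁t₂, m) > 1`: the symbol `(dm/(t₁t₂))` vanishes, and so does `β`
    have ht₁0 : 0 < t₁ := lt_of_le_of_lt (Nat.zero_le _) (mem_Ioc.mp ht₁).1
    have ht₂0 : 0 < t₂ := lt_of_le_of_lt (Nat.zero_le _) (mem_Ioc.mp ht₂).1
    have hJ : ∀ d : ℕ, J(((d * m : ℕ) : ℤ) | t₁ * t₂) = 0 := by
      intro d
      rw [jacobiSym.eq_zero_iff]
      refine ⟨(Nat.mul_pos ht₁0 ht₂0).ne', fun hg => hm' ?_⟩
      rw [Int.gcd_natCast_natCast] at hg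
      have h1 : Nat.Coprime m (t₁ * t₂) := Nat.Coprime.coprime_dvd_left ⟨d, by ring⟩ hg
      exact ⟨(Nat.Coprime.coprime_dvd_right ⟨t₂, rfl⟩ h1).symm,
        (Nat.Coprime.coprime_dvd_right ⟨t₁, by ring⟩ h1).symm⟩
    rw [sum_eq_zero fun d _ => by rw [hJ d]; simp, sum_eq_zero fun q _ => ?_]
    rw [not_and_or] at hm'
    rcases hm' with h | h
    · rw [if_neg h]; simp
    · simp only [if_neg h, map_zero, mul_zero, zero_mul, ite_self]
  -- the main case
  obtain ⟨hm₁, hm₂⟩ := hm'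
  obtain ⟨hodd₁, hs₁'⟩ := odd_and_coprime_of_coprime_two_mul (hα _ _ hα₁)
  obtain ⟨hodd₂, hs₂'⟩ := odd_and_coprime_of_coprime_two_mul (hα _ _ hα₂)
  have hot₁ : Odd t₁ := Nat.Odd.of_mul_right hodd₁
  have hot₂ : Odd t₂ := Nat.Odd.of_mul_right hodd₂
  have hst₁ : s₁.Coprime t₁ := Nat.Coprime.coprime_dvd_right ⟨c, by ring⟩ hs₁'
  have hst₂ : s₂.Coprime t₂ := Nat.Coprime.coprime_dvd_right ⟨c, by ring⟩ hs₂'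
  have h4 : t₁ % 4 = t₂ % 4 := by
    have h := hα4 _ _ _ _ hα₁ hα₂
    have h4c : Nat.Coprime (2 ^ 2) c := Nat.Coprime.pow_left 2 (Nat.coprime_two_left.mpr hc)
    norm_num at h4c
    exact Nat.ModEq.cancel_left_of_coprime h4c h
  have hΔL : Δ.natAbs ≤ L := by
    have ht₁' : t₁ ≤ 2 * R := (mem_Ioc.mp ht₁).2.trans (Nat.div_le_self _ _)
    have ht₂' : t₂ ≤ 2 * R := (mem_Ioc.mp ht₂).2.trans (Nat.div_le_self _ _)
    have hs₁2 : s₁ ≤ 2 * S := (mem_Ioc.mp hs₁).2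
    have hs₂2 : s₂ ≤ 2 * S := (mem_Ioc.mp hs₂).2
    have ha : t₁ * s₂ ≤ 2 * R * (2 * S) := Nat.mul_le_mul ht₁' hs₂2
    have hb : t₂ * s₁ ≤ 2 * R * (2 * S) := Nat.mul_le_mul ht₂' hs₁2
    have he : Δ = ((t₁ * s₂ : ℕ) : ℤ) - ((t₂ * s₁ : ℕ) : ℤ) := by rw [hΔ]; push_cast; ring
    rw [he]
    have : 2 * R * (2 * S) = 4 * R * S := by ring
    omega
  have hflip := sum_ite_dvd_jacobiSym_eq_flip hm hot₁ hot₂ hcop h4 hst₁ hst₂ hΔ0 hΔL w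
  -- factor the pair data out of both sums
  have hL' : ∑ d ∈ Ioc 0 L, w (d * m) *
      (if ((d * m : ℕ) : ℤ) ∣ Δ ∧ t₁.Coprime t₂ then
        (J(((d * m : ℕ) : ℤ) | t₁ * t₂) : ℂ) * (α (c * t₁) s₁ * conj (α (c * t₂) s₂) * G t₁ s₁ t₂ s₂)
        else 0) =
      (α (c * t₁) s₁ * conj (α (c * t₂) s₂) * G t₁ s₁ t₂ s₂) *
        ∑ d ∈ Ioc 0 L, (if ((d * m : ℕ) : ℤ) ∣ Δ then
          w (d * m) * (J(((d * m : ℕ) : ℤ) | t₁ * t₂) : ℂ) else 0) := by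
    rw [mul_sum]
    refine sum_congr rfl fun d _ => ?_
    by_cases h : ((d * m : ℕ) : ℤ) ∣ Δ
    · rw [if_pos ⟨h, hcop⟩, if_pos h]; ring
    · rw [if_neg (fun h' => h h'.1), if_neg h]; ring
  have hR' : ∑ q ∈ Ioc 0 L, (if ((q * m : ℕ) : ℤ) ∣ Δ ∧ t₁.Coprime t₂ then
      (if t₁.Coprime m then (J((s₁ : ℤ) | t₁) : ℂ) * α (c * t₁) s₁ else 0) *
        conj (if t₂.Coprime m then (J((s₂ : ℤ) | t₂) : ℂ) * α (c * t₂) s₂ else 0) *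
        (J((q : ℤ) | t₁ * t₂) : ℂ) * (w (Δ.natAbs / q) * G t₁ s₁ t₂ s₂) else 0) =
      (α (c * t₁) s₁ * conj (α (c * t₂) s₂) * G t₁ s₁ t₂ s₂) *
        ((J((s₁ : ℤ) | t₁) : ℂ) * (J((s₂ : ℤ) | t₂) : ℂ) *
          ∑ q ∈ Ioc 0 L, (if ((q * m : ℕ) : ℤ) ∣ Δ then
            w (Δ.natAbs / q) * (J((q : ℤ) | t₁ * t₂) : ℂ) else 0)) := by
    rw [mul_sum, mul_sum]
    refine sum_congr rfl fun q _ => ?_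
    rw [if_pos hm₁, if_pos hm₂, map_mul, map_intCast]
    by_cases h : ((q * m : ℕ) : ℤ) ∣ Δ
    · rw [if_pos ⟨h, hcop⟩, if_pos h]; ring
    · rw [if_neg (fun h' => h h'.1), if_neg h]; ring
  rw [hL', hR', hflip]

end Literature.NumberTheory.Sieve.FriedlanderIwaniecPrimes
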